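import Literature.AnabelianGeometry.SemiGraphs.TreeSystemUnfoldedFixedSubjoint
import Literature.AnabelianGeometry.SemiGraphs.TemperedFixedSystemOfFiniteImages
import Literature.AnabelianGeometry.SemiGraphs.TreeSystemFixedPair
import HarnessLib

/-!
# [SemiAnbd] Thm 3.7 (iii) beyond finite `𝔾`: (FIX∞) from «eventually no unfolded fixed subjoint»

Mochizuki, *Semi-graphs of anabelioids*, Publ. RIMS **42** (2006), §3, Theorem 3.7 (iii), manuscript
p. 41, third paragraph with the author's *Comments* (2020) (6)(b) ("each of the nonempty sets `E_{j,i}`,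
for `i` sufficiently large relative to `j`, is of cardinality 1 … a compatible system of vertices … fixed
by `H`"; "if `H` fixes two vertices of `𝒢_{∞,j}`, then these two vertices are joined to one another by a
single edge") [cite: MochizukiSemiAnbd2006, Thm 3.7(iii) p.41].

PROOF-ONLY (cell abc-iut, layer L3, GAP row G-t6g3-2b, sub-row (B3-U) «uniform assembly» of
abc-iut-w6-d066's «T37iii·LOCFIN-PERSIST»; seat abc-iut-w5-d212; no definition, no named fact).  Over an
ABSTRACT `D : VerticialLevelData 𝒢 c` and a compact `C ≤ π₁^temp(𝒢)`, the ONE hypothesis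

  (hno∞) «eventually no unfolded `C`-fixed subjoint»: for every level `j` there is `k ≥ j` such that for
  every `k' ≥ k` no `C`-fixed subjoint `(y; δ₁ ≠ δ)` of the tree `𝒢_{∞,k'}` has its two branches mapped to
  DISTINCT branches by the transition `𝒢_{∞,k'} → 𝒢_{∞,j}`

yields BOTH clauses of the fixed-systems input (FIX∞) of abc-iut-L3-t10's
`VerticialLevelData.compactInVerticial_of_fixedSystems` (p427835):

* `VerticialLevelData.finite_images_of_eventually_noUnfolded` — the level-`j` images of the `C`-fixed loci
  of the levels `k' ≥ k` are finite (indeed ≤ 2 adjacent vertices; tree half: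
  `SemiGraph.finite_image_fixed_of_noUnfoldedFixedSubjoint`, `TreeSystemUnfoldedFixedSubjoint.lean`) — the
  hypothesis `hfin` of abc-iut-w6-d066's `hfix_of_eventually_finite_images`;
* `VerticialLevelData.hfix_of_eventually_noUnfolded` — hence (hfix): `C` fixes a compatible vertex system;
* `VerticialLevelData.hadj_of_eventually_noUnfolded` — (hadj): two compatible `C`-fixed systems are, at
  every level where they differ, the two ends of ONE edge, which is `C`-fixed (the conclusion shape of
  abc-iut-w6-d066's `hadj_of_eventually_edge_images`; tree half `SemiGraph.eq_or_joins_of_noUnfoldedFixedSubjoint`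
  + abc-iut-L3-t11's `SemiGraph.edge_unique_of_abuts`).

Where (hno∞) comes from (NOT proved here): per base subjoint it is the output of total estrangement via
the Kőnig selections of abc-iut-w5-d189 / the kill of abc-iut-L3-t10 (`eq_bot_of_fixedSubjointSystem`);
it holds UNIFORMLY when the relevant family of base subjoints is finite (finite `𝔾`: abc-iut-w6-d066's
(B3-L) + finiteness of `𝔾_j`; cofinite tower symmetry), and it FAILS along the escaping ray of the
countermodel `𝒢_θ` (abc-iut-L3-d1, `ThetaRayEscape.lean`).  Nothing here asserts (hno∞) for any `𝒢`;
nothing bears on [IUTchIII] Cor. 3.12.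
-/

namespace Literature.AnabelianGeometry.SemiGraphs

namespace ProfiniteSemiGraph

namespace VerticialLevelData

open CategoryTheory Topology

universe v u

variable {𝒢 : ProfiniteSemiGraph.{u}} {c : TemperedPiChart 𝒢} (D : VerticialLevelData.{v} 𝒢 c)

/-- **Eventually no unfolded fixed subjoint ⇒ eventually finite images** (Comments (2020) (6)(b)
"`E_{j,i}` … of cardinality 1"): if from some level `k ≥ j` on no `C`-fixed subjoint of `𝒢_{∞,k'}` is
unfolded by `𝒢_{∞,k'} → 𝒢_{∞,j}`, then the level-`j` image of the `C`-fixed locus of `𝒢_{∞,k}` is finite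
— the hypothesis `hfin` of `hfix_of_eventually_finite_images`. [cite: MochizukiSemiAnbd2006, Thm 3.7(iii) p.41] -/
theorem finite_images_of_eventually_noUnfolded (C : Subgroup c.G)
    (hno : ∀ j : D.J, ∃ (k : D.J) (h : j ≤ k), ∀ (k' : D.J) (h' : k ≤ k'),
      ∀ (y : (D.tree k').Vertex) (δ₁ δ : (D.tree k').Branch), δ₁ ≠ δ →
        (D.tree k').abuts δ₁ = some y → (D.tree k').abuts δ = some y →
        (∀ g ∈ C, (D.act k' g).hom.vertexMap y = y ∧ (D.act k' g).hom.branchMap δ₁ = δ₁ ∧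
          (D.act k' g).hom.branchMap δ = δ) →
        (D.trans (h.trans h')).branchMap δ₁ = (D.trans (h.trans h')).branchMap δ) (j : D.J) :
    ∃ (k : D.J) (h : j ≤ k),
      ((D.trans h).vertexMap '' {x : (D.tree k).Vertex | ∀ g ∈ C, (D.act k g).hom.vertexMap x = x}).Finite := by
  obtain ⟨k, h, hk⟩ := hno j
  refine ⟨k, h, ?_⟩
  have hset : {x : (D.tree k).Vertex | ∀ g ∈ C, (D.act k g).hom.vertexMap x = x} =
      {x : (D.tree k).Vertex | ∀ γ : C, (D.act k γ).hom.vertexMap x = x} := by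
    ext x
    exact ⟨fun hx γ => hx γ γ.2, fun hx g hg => hx ⟨g, hg⟩⟩
  have e : (h.trans (le_refl k) : j ≤ k) = h := rfl
  rw [hset]
  have hfin := SemiGraph.finite_image_fixed_of_noUnfoldedFixedSubjoint C (D.isTree k) (D.isTree j)
    (D.act k) (D.trans h) (fun y δ₁ δ hne h₁ h₂ hfix => by
      have := hk k (le_refl k) y δ₁ δ hne h₁ h₂ (fun g hg => hfix ⟨g, hg⟩)
      rwa [e] at this)
  exact hfin

/-- **(hfix) from «eventually no unfolded fixed subjoint»** ([SemiAnbd] p. 41 "a compatible system of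
vertices of `𝒢_{∞,j}` … each of which is fixed by `H`"): a compact `C ≤ π₁^temp(𝒢)` satisfying (hno∞)
fixes a compatible system of tree vertices — via abc-iut-w6-d066's `hfix_of_eventually_finite_images`.
[cite: MochizukiSemiAnbd2006, Thm 3.7(iii) p.41] -/
theorem hfix_of_eventually_noUnfolded (C : Subgroup c.G) (hC : IsCompact (C : Set c.G))
    (hno : ∀ j : D.J, ∃ (k : D.J) (h : j ≤ k), ∀ (k' : D.J) (h' : k ≤ k'),
      ∀ (y : (D.tree k').Vertex) (δ₁ δ : (D.tree k').Branch), δ₁ ≠ δ →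
        (D.tree k').abuts δ₁ = some y → (D.tree k').abuts δ = some y →
        (∀ g ∈ C, (D.act k' g).hom.vertexMap y = y ∧ (D.act k' g).hom.branchMap δ₁ = δ₁ ∧
          (D.act k' g).hom.branchMap δ = δ) →
        (D.trans (h.trans h')).branchMap δ₁ = (D.trans (h.trans h')).branchMap δ) :
    ∃ x : ∀ j, (D.tree j).Vertex, (∀ ⦃i j : D.J⦄ (h : i ≤ j), (D.trans h).vertexMap (x j) = x i) ∧
      ∀ g ∈ C, ∀ j, (D.act j g).hom.vertexMap (x j) = x j :=
  D.hfix_of_eventually_finite_images C hC (D.finite_images_of_eventually_noUnfolded C hno)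

/-- **(hadj) from «eventually no unfolded fixed subjoint»** ([SemiAnbd] p. 41 "if `H` fixes two vertices
of `𝒢_{∞,j}`, then these two vertices are joined to one another by a single [closed] edge"): two compatible
`C`-fixed vertex systems `x, x'` with `x j ≠ x' j` are the two ends of one edge of `𝒢_{∞,j}` through
distinct branches, and that edge is fixed by `C` — the conclusion shape of abc-iut-w6-d066's
`hadj_of_eventually_edge_images`. [cite: MochizukiSemiAnbd2006, Thm 3.7(iii) p.41] -/
theorem hadj_of_eventually_noUnfolded (C : Subgroup c.G)
    (hno : ∀ j : D.J, ∃ (k : D.J) (h : j ≤ k), ∀ (k' : D.J) (h' : k ≤ k'),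
      ∀ (y : (D.tree k').Vertex) (δ₁ δ : (D.tree k').Branch), δ₁ ≠ δ →
        (D.tree k').abuts δ₁ = some y → (D.tree k').abuts δ = some y →
        (∀ g ∈ C, (D.act k' g).hom.vertexMap y = y ∧ (D.act k' g).hom.branchMap δ₁ = δ₁ ∧
          (D.act k' g).hom.branchMap δ = δ) →
        (D.trans (h.trans h')).branchMap δ₁ = (D.trans (h.trans h')).branchMap δ)
    (x x' : ∀ j, (D.tree j).Vertex)
    (hx : ∀ ⦃i j : D.J⦄ (h : i ≤ j), (D.trans h).vertexMap (x j) = x i)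
    (hx' : ∀ ⦃i j : D.J⦄ (h : i ≤ j), (D.trans h).vertexMap (x' j) = x' i)
    (hfx : ∀ g ∈ C, ∀ j, (D.act j g).hom.vertexMap (x j) = x j)
    (hfx' : ∀ g ∈ C, ∀ j, (D.act j g).hom.vertexMap (x' j) = x' j)
    (j : D.J) (hne : x j ≠ x' j) :
    ∃ (e : (D.tree j).Edge) (b b' : (D.tree j).Branch), b ≠ b' ∧
      (D.tree j).edgeOf b = e ∧ (D.tree j).edgeOf b' = e ∧
      (D.tree j).abuts b = some (x j) ∧ (D.tree j).abuts b' = some (x' j) ∧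
      ∀ g ∈ C, (D.act j g).hom.edgeMap e = e := by
  obtain ⟨k, h, hk⟩ := hno j
  have e0 : (h.trans (le_refl k) : j ≤ k) = h := rfl
  -- the images of the fixed vertices `x k`, `x' k` are `x j ≠ x' j`: equal or joined by an edge
  have hor := SemiGraph.eq_or_joins_of_noUnfoldedFixedSubjoint C (D.isTree k) (D.isTree j) (D.act k)
    (D.trans h) (fun y δ₁ δ hne' h₁ h₂ hfix => by
      have := hk k (le_refl k) y δ₁ δ hne' h₁ h₂ (fun g hg => hfix ⟨g, hg⟩)
      rwa [e0] at this)
    (x k) (x' k) (fun γ => hfx γ γ.2 k) (fun γ => hfx' γ γ.2 k)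
  rw [hx h, hx' h] at hor
  rcases hor with heq | ⟨e, b, b', hbb', hbe, hb'e, hbx, hb'x⟩
  · exact absurd heq hne
  refine ⟨e, b, b', hbb', hbe, hb'e, hbx, hb'x, fun g hg => ?_⟩
  -- the translate of `e` by `g` joins `g · x j = x j` and `g · x' j = x' j`
  set φ := (D.act j g).hom with hφ
  have h₁ : (D.tree j).abuts (φ.branchMap b) = some (x j) := by
    rw [φ.abuts_branchMap b (x j) hbx, hfx g hg j]
  have h₂ : (D.tree j).abuts (φ.branchMap b') = some (x' j) := by
    rw [φ.abuts_branchMap b' (x' j) hb'x, hfx' g hg j]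
  exact (SemiGraph.edge_unique_of_abuts (D.isTree j) hne hbe hb'e
    ((φ.edgeOf_branchMap b).trans (by rw [hbe])) ((φ.edgeOf_branchMap b').trans (by rw [hb'e]))
    hbx hb'x h₁ h₂).symm

end VerticialLevelData

end ProfiniteSemiGraph

end Literature.AnabelianGeometry.SemiGraphs
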